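import Mathlib.AlgebraicGeometry.Morphisms.Separated
import Mathlib.RingTheory.DedekindDomain.Factorization
import Mathlib.CategoryTheory.Monoidal.Cartesian.Over
import HarnessLib

/-!
# Morphisms to a separated scheme agreeing at infinitely many closed points of a Dedekind scheme

Let `R` be a Dedekind domain, `S = Spec R`, and let `𝒜 → S` be a SEPARATED `S`-scheme (e.g. a proper
smooth group scheme — an abelian scheme, a Néron model).  Two sections `s₁, s₂ : S → 𝒜` which agree at
infinitely many closed points `𝔪` (i.e. `Spec κ(𝔪) → S ⇉ 𝒜` coincide, or the reductions
`s₁ mod 𝔪 = s₂ mod 𝔪` coincide) are EQUAL.  Proof: the equaliser of `s₁, s₂` is a closed subscheme of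
`S` (`𝒜/S` separated, Mathlib `isClosedImmersion_equalizer_ι_left`) whose support contains infinitely
many closed points; a closed subset of `Spec R` containing infinitely many points is everything (a
nonzero ideal of a Dedekind domain has finitely many prime factors, Mathlib `Ideal.finite_factors`), so
the equaliser is a surjective closed immersion onto the reduced scheme `S`, hence an isomorphism
(Mathlib `ext_of_isDominant_of_isSeparated`).

This is junction J-d of the abc-iut cell's route to [AbsTopIII] Rmk. 1.5.4 (i) («sub-`p`-adic ⟹
Kummer-faithful», the abelian-variety clause over finitely generated extensions of `ℚ_p`, by
specialisation to closed points of a Dedekind curve: a divisible section of an abelian scheme dies in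
every special fibre over a `p`-adic field, hence is trivial).  Everything here is Mathlib-only scheme
theory; no named facts, no definitions.

Contents:
* `PrimeSpectrum.vanishingIdeal_eq_bot_of_infinite`, `PrimeSpectrum.dense_of_infinite` — an infinite
  set of points of `Spec R`, `R` Dedekind, is dense;
* `ext_of_dense_of_forall_exists_comp_eq` — Mathlib's `ext_of_fromSpecResidueField_eq` with the residue
  fields replaced by ARBITRARY test morphisms hitting a dense set of points (reduced source, separated
  target);
* `ext_of_infinite_of_forall_exists_comp_eq`, `ext_of_infinite_quotient` — the Dedekind case: agreement
  after `Spec (R ⧸ 𝔭) → Spec R` for infinitely many primes `𝔭`;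
* `Over.hom_ext_of_dense`, `Over.hom_ext_of_infinite_quotient`, `Over.tensorUnit_hom_ext_of_infinite_quotient`
  — the same for morphisms / sections in `Over (Spec R)`;
* `Over.comp_left_eq_of_pullback_map_eq`, `Over.tensorUnit_hom_ext_of_infinite_pullback` — the
  hypothesis in BASE-CHANGE form: `(Over.pullback ι_𝔪).map s₁ = (Over.pullback ι_𝔪).map s₂` for
  infinitely many `𝔪`;
* `Over.tensorUnit_hom_ext_of_forall_maximal_quotient`, `Over.tensorUnit_hom_ext_of_forall_maximal_pullback`
  — the form the specialisation argument consumes: agreement at EVERY maximal ideal of a Dedekind domain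
  with infinitely many maximal ideals.

## References

* R. Hartshorne, *Algebraic Geometry*, GTM 52 (1977), II Ex. 4.2 (morphisms from a reduced scheme to a
  separated scheme agreeing on a dense open are equal). [Hartshorne1977]
* The Stacks Project, Tag 01KM (the equaliser of two morphisms to a separated scheme is a closed
  subscheme), Tag 01JO (base change). [StacksProject]
* J. Neukirch, *Algebraic Number Theory* (1999), Ch. I §3 Thm. (3.3) (unique factorisation of ideals in
  a Dedekind domain; hence a nonzero ideal has finitely many prime divisors). [NeukirchANT1999]
* M. Atiyah, I. Macdonald, *Introduction to Commutative Algebra* (1969), Ch. 1 Ex. 21 (iv)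
  (`Spec (A/𝔞) → Spec A` is a homeomorphism onto `V(𝔞)`). [AtiyahMacdonald1969]
* S. Bosch, W. Lütkebohmert, M. Raynaud, *Néron Models* (1990), §1.2 (context: sections of Néron
  models). [BLRNeronModels1990]
-/

noncomputable section

universe u

open CategoryTheory AlgebraicGeometry Limits TopologicalSpace
open scoped MonoidalCategory

namespace Literature.AlgebraicGeometry.Morphisms

/-! ### Infinite subsets of a Dedekind spectrum are dense -/

/-- In a Dedekind domain `R`, an infinite set `T` of prime ideals has zero intersection: a nonzero
ideal is contained in only finitely many primes (its prime factors, Mathlib `Ideal.finite_factors`).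
[cite: NeukirchANT1999, Ch. I §3 Thm. (3.3)] -/
theorem PrimeSpectrum.vanishingIdeal_eq_bot_of_infinite {R : Type u} [CommRing R] [IsDedekindDomain R]
    (T : Set (PrimeSpectrum R)) (hT : T.Infinite) : PrimeSpectrum.vanishingIdeal T = ⊥ := by
  by_contra hJ
  apply hT
  set J := PrimeSpectrum.vanishingIdeal T with hJdef
  have hle : ∀ x ∈ T, J ≤ x.asIdeal := fun x hx f hf =>
    (PrimeSpectrum.mem_vanishingIdeal T f).1 hf x hx
  have hne : ∀ x ∈ T, x.asIdeal ≠ ⊥ := fun x hx h => hJ (le_bot_iff.1 (h ▸ hle x hx))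
  have hfin := (Ideal.finite_factors hJ).to_subtype
  let φ : T → {v : IsDedekindDomain.HeightOneSpectrum R | v.asIdeal ∣ J} := fun x =>
    ⟨⟨x.1.asIdeal, x.1.isPrime, hne x.1 x.2⟩, Ideal.dvd_iff_le.2 (hle x.1 x.2)⟩
  have hφ : Function.Injective φ := by
    rintro ⟨x, hx⟩ ⟨y, hy⟩ h
    have h' := congrArg (fun v => v.1.asIdeal) h
    exact Subtype.ext (PrimeSpectrum.ext h')
  haveI : Finite T := Finite.of_injective φ hφ
  exact Set.toFinite T

/-- In the spectrum of a Dedekind domain, every infinite set of points is dense (its closure is the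
zero locus of its vanishing ideal, which is `⊥`). [cite: NeukirchANT1999, Ch. I §3 Thm. (3.3)] -/
theorem PrimeSpectrum.dense_of_infinite {R : Type u} [CommRing R] [IsDedekindDomain R]
    (T : Set (PrimeSpectrum R)) (hT : T.Infinite) : Dense T := by
  rw [dense_iff_closure_eq, ← PrimeSpectrum.zeroLocus_vanishingIdeal_eq_closure,
    PrimeSpectrum.vanishingIdeal_eq_bot_of_infinite T hT]
  exact PrimeSpectrum.zeroLocus_bot

/-- The same density statement for the underlying space of the scheme `Spec R`. [cite: NeukirchANT1999, Ch. I §3 Thm. (3.3)] -/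
theorem dense_of_infinite_spec {R : Type u} [CommRing R] [IsDedekindDomain R]
    (T : Set (Spec (CommRingCat.of R) : Scheme.{u})) (hT : T.Infinite) : Dense T :=
  PrimeSpectrum.dense_of_infinite (R := R) T hT

/-! ### Morphisms to a separated scheme agreeing on a dense set of points -/

/-- **Equaliser argument** (Hartshorne II Ex. 4.2; Stacks 01KM).  Let `X` be reduced, `i : Y → Z` separated and
`f, g : X → Y` with `f ≫ i = g ≫ i`.  If every point of a DENSE subset `S ⊆ X` lies in the image of
some morphism `t : W → X` with `t ≫ f = t ≫ g`, then `f = g`: the equaliser of `f, g` is a closed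
subscheme of `X` through which each such `t` factors, so it is dominant, hence (reduced `X`) all of
`X`.  (Mathlib's `ext_of_fromSpecResidueField_eq` is the case `t = Spec κ(x) → X`.) [cite: Hartshorne1977, II Ex. 4.2] -/
theorem ext_of_dense_of_forall_exists_comp_eq {X Y Z : Scheme.{u}} (f g : X ⟶ Y) (i : Y ⟶ Z)
    [IsSeparated i] [IsReduced X] (H' : f ≫ i = g ≫ i) (S : Set X) (hS : Dense S)
    (H : ∀ x ∈ S, ∃ (W : Scheme.{u}) (t : W ⟶ X), x ∈ Set.range t ∧ t ≫ f = t ≫ g) :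
    f = g := by
  suffices IsDominant (equalizer.ι f g) from
    ext_of_isDominant_of_isSeparated i H' (equalizer.ι f g) (equalizer.condition _ _)
  refine ⟨.mono (fun x hx => ?_) hS⟩
  obtain ⟨W, t, ⟨w, rfl⟩, ht⟩ := H x hx
  exact ⟨equalizer.lift t ht w, by rw [← Scheme.Hom.comp_apply, equalizer.lift_ι]⟩

/-- **Dedekind base.**  Let `R` be a Dedekind domain, `i : Y → Z` separated and
`f, g : Spec R → Y` with `f ≫ i = g ≫ i`.  If infinitely many points `x` of `Spec R` lie in the image
of some `t : W → Spec R` with `t ≫ f = t ≫ g`, then `f = g` (an infinite subset of `Spec R` is dense;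
`Spec R` is reduced). [cite: Hartshorne1977, II Ex. 4.2] -/
theorem ext_of_infinite_of_forall_exists_comp_eq {R : Type u} [CommRing R] [IsDedekindDomain R]
    {Y Z : Scheme.{u}} (f g : Spec (CommRingCat.of R) ⟶ Y) (i : Y ⟶ Z) [IsSeparated i]
    (H' : f ≫ i = g ≫ i) (S : Set (Spec (CommRingCat.of R) : Scheme.{u})) (hS : S.Infinite)
    (H : ∀ x ∈ S, ∃ (W : Scheme.{u}) (t : W ⟶ Spec (CommRingCat.of R)),
      x ∈ Set.range t ∧ t ≫ f = t ≫ g) :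
    f = g :=
  ext_of_dense_of_forall_exists_comp_eq f g i H' S (dense_of_infinite_spec S hS) H

/-- The closed subscheme `Spec (R ⧸ 𝔭) → Spec R` passes through the point `𝔭`. [cite: AtiyahMacdonald1969, Ch. 1 Ex. 21 (iv)] -/
theorem mem_range_spec_map_quotient_mk {R : Type u} [CommRing R] (𝔭 : Ideal R) [𝔭.IsPrime] :
    (⟨𝔭, inferInstance⟩ : (Spec (CommRingCat.of R) : Scheme.{u})) ∈
      Set.range (Spec.map (CommRingCat.ofHom (Ideal.Quotient.mk 𝔭))) := by
  haveI : IsDomain (R ⧸ 𝔭) := Ideal.Quotient.isDomain 𝔭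
  refine ⟨(⟨⊥, Ideal.isPrime_bot⟩ : PrimeSpectrum (R ⧸ 𝔭)), ?_⟩
  rw [Spec.map_apply]
  apply PrimeSpectrum.ext
  change Ideal.comap (Ideal.Quotient.mk 𝔭) ⊥ = 𝔭
  rw [← RingHom.ker_eq_comap_bot, Ideal.mk_ker]

/-- **Dedekind base, reductions modulo primes.**  Let `R` be a Dedekind domain, `i : Y → Z` separated,
`f, g : Spec R → Y` with `f ≫ i = g ≫ i`.  If `f` and `g` agree after restriction to the closed
subschemes `Spec (R ⧸ 𝔭) → Spec R` for an INFINITE set `T` of prime ideals `𝔭` (e.g. infinitely many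
maximal ideals: "the reductions of the two sections agree at infinitely many closed points"), then
`f = g`. [cite: Hartshorne1977, II Ex. 4.2] -/
theorem ext_of_infinite_quotient {R : Type u} [CommRing R] [IsDedekindDomain R]
    {Y Z : Scheme.{u}} (f g : Spec (CommRingCat.of R) ⟶ Y) (i : Y ⟶ Z) [IsSeparated i]
    (H' : f ≫ i = g ≫ i) (T : Set (Ideal R)) (hT : T.Infinite) (hprime : ∀ 𝔭 ∈ T, 𝔭.IsPrime)
    (H : ∀ (𝔭 : Ideal R) (h𝔭 : 𝔭 ∈ T),
      Spec.map (CommRingCat.ofHom (Ideal.Quotient.mk 𝔭)) ≫ f =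
        Spec.map (CommRingCat.ofHom (Ideal.Quotient.mk 𝔭)) ≫ g) :
    f = g := by
  -- the points of `Spec R` named by `T`
  let pt : T → (Spec (CommRingCat.of R) : Scheme.{u}) := fun 𝔭 => ⟨𝔭.1, hprime 𝔭.1 𝔭.2⟩
  have hpt : Function.Injective pt := by
    rintro ⟨𝔭, h𝔭⟩ ⟨𝔮, h𝔮⟩ h
    exact Subtype.ext (congrArg PrimeSpectrum.asIdeal h :)
  have hS : (Set.range pt).Infinite := by
    haveI : Infinite T := hT.to_subtype
    exact Set.infinite_range_of_injective hpt
  refine ext_of_infinite_of_forall_exists_comp_eq f g i H' (Set.range pt) hS ?_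
  rintro _ ⟨⟨𝔭, h𝔭⟩, rfl⟩
  haveI : 𝔭.IsPrime := hprime 𝔭 h𝔭
  exact ⟨_, Spec.map (CommRingCat.ofHom (Ideal.Quotient.mk 𝔭)), mem_range_spec_map_quotient_mk 𝔭,
    H 𝔭 h𝔭⟩

/-- The residue-field form (Mathlib's `ext_of_fromSpecResidueField_eq` on a Dedekind base): two
morphisms `Spec R → Y` over a separated `Y → Z` which agree on `Spec κ(x) → Spec R` for infinitely many
points `x` are equal. [cite: Hartshorne1977, II Ex. 4.2] -/
theorem ext_of_infinite_fromSpecResidueField {R : Type u} [CommRing R] [IsDedekindDomain R]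
    {Y Z : Scheme.{u}} (f g : Spec (CommRingCat.of R) ⟶ Y) (i : Y ⟶ Z) [IsSeparated i]
    (H' : f ≫ i = g ≫ i) (S : Set (Spec (CommRingCat.of R) : Scheme.{u})) (hS : S.Infinite)
    (H : ∀ x ∈ S, (Spec (CommRingCat.of R)).fromSpecResidueField x ≫ f =
      (Spec (CommRingCat.of R)).fromSpecResidueField x ≫ g) :
    f = g :=
  ext_of_fromSpecResidueField_eq f g i S (dense_of_infinite_spec S hS) H H'

/-! ### The same in the over category `Over S` (sections of separated `S`-schemes) -/

/-- **Over-category form.**  Let `X, Y` be schemes over `S` with `X` reduced and `Y → S` separated, and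
`f, g : X → Y` morphisms over `S`.  If every point of a dense subset of `X` is in the image of some
`t : W → X` with `t ≫ f = t ≫ g` (on underlying schemes), then `f = g`. [cite: Hartshorne1977, II Ex. 4.2] -/
theorem Over.hom_ext_of_dense {S : Scheme.{u}} {X Y : Over S} [IsSeparated Y.hom] [IsReduced X.left]
    (f g : X ⟶ Y) (T : Set X.left) (hT : Dense T)
    (H : ∀ x ∈ T, ∃ (W : Scheme.{u}) (t : W ⟶ X.left), x ∈ Set.range t ∧ t ≫ f.left = t ≫ g.left) :
    f = g := by
  ext1
  exact ext_of_dense_of_forall_exists_comp_eq f.left g.left Y.hom (by rw [Over.w, Over.w]) T hT H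

/-- **Sections over a Dedekind base, reductions modulo primes.**  Let `R` be a Dedekind domain,
`Y → Spec R` separated, and `f, g : Spec R → Y` two morphisms over `Spec R` from the object
`Over.mk (𝟙 (Spec R))`.  If `f` and `g` agree on the closed subschemes `Spec (R ⧸ 𝔭)` for an infinite
set `T` of primes `𝔭`, then `f = g`. [cite: Hartshorne1977, II Ex. 4.2] -/
theorem Over.hom_ext_of_infinite_quotient {R : Type u} [CommRing R] [IsDedekindDomain R]
    {Y : Over (Spec (CommRingCat.of R))} [IsSeparated Y.hom]
    (f g : Over.mk (𝟙 (Spec (CommRingCat.of R))) ⟶ Y) (T : Set (Ideal R)) (hT : T.Infinite)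
    (hprime : ∀ 𝔭 ∈ T, 𝔭.IsPrime)
    (H : ∀ (𝔭 : Ideal R) (h𝔭 : 𝔭 ∈ T),
      Spec.map (CommRingCat.ofHom (Ideal.Quotient.mk 𝔭)) ≫ f.left =
        Spec.map (CommRingCat.ofHom (Ideal.Quotient.mk 𝔭)) ≫ g.left) :
    f = g := by
  ext1
  exact ext_of_infinite_quotient f.left g.left Y.hom ((Over.w f).trans (Over.w g).symm) T hT hprime H

/-- **Sections `𝟙_ (Over (Spec R)) → 𝒜` of a separated `R`-scheme** (the form in which the points
`𝒜(R)` of a Néron model / abelian scheme appear, cf. `IsNeronModel.sectionsEquiv`): two sections which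
agree modulo infinitely many primes `𝔭` of the Dedekind domain `R` are equal. [cite: Hartshorne1977, II Ex. 4.2] -/
theorem Over.tensorUnit_hom_ext_of_infinite_quotient {R : Type u} [CommRing R] [IsDedekindDomain R]
    {𝒜 : Over (Spec (CommRingCat.of R))} [IsSeparated 𝒜.hom]
    (s₁ s₂ : 𝟙_ (Over (Spec (CommRingCat.of R))) ⟶ 𝒜) (T : Set (Ideal R)) (hT : T.Infinite)
    (hprime : ∀ 𝔭 ∈ T, 𝔭.IsPrime)
    (H : ∀ (𝔭 : Ideal R) (h𝔭 : 𝔭 ∈ T),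
      Spec.map (CommRingCat.ofHom (Ideal.Quotient.mk 𝔭)) ≫ s₁.left =
        Spec.map (CommRingCat.ofHom (Ideal.Quotient.mk 𝔭)) ≫ s₂.left) :
    s₁ = s₂ :=
  Over.hom_ext_of_infinite_quotient s₁ s₂ T hT hprime H

/-! ### Hypothesis in base-change form -/

/-- If two `S`-morphisms `f, g : X → Y` have the same base change along `ι : S' → S`
(`(Over.pullback ι).map f = (Over.pullback ι).map g`), then `f` and `g` agree after composition with
the projection `X ×_S S' → X`. [cite: StacksProject, Tag 01JO] -/
theorem Over.pullback_fst_comp_left_eq_of_pullback_map_eq {S S' : Scheme.{u}} (ι : S' ⟶ S)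
    {X Y : Over S} (f g : X ⟶ Y) (h : (Over.pullback ι).map f = (Over.pullback ι).map g) :
    pullback.fst X.hom ι ≫ f.left = pullback.fst X.hom ι ≫ g.left := by
  -- `(f ×_S S') ≫ pr₁ = pr₁ ≫ f` on underlying schemes (definition of `Over.pullback`)
  have key : ∀ k : X ⟶ Y,
      @Eq (pullback X.hom ι ⟶ Y.left) (((Over.pullback ι).map k).left ≫ pullback.fst Y.hom ι)
        (pullback.fst X.hom ι ≫ k.left) :=
    fun k => pullback.lift_fst _ _ _
  exact ((key f).symm.trans (congrArg
    (fun m : (Over.pullback ι).obj X ⟶ (Over.pullback ι).obj Y =>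
      (m.left ≫ pullback.fst Y.hom ι : pullback X.hom ι ⟶ Y.left)) h)).trans (key g)

/-- If two `S`-morphisms `f, g : X → Y` have the same base change along `ι : S' → S`, then they agree
after composition with every `j : S' → X` lying over `ι` (lift `j` to `X ×_S S'`). [cite: StacksProject, Tag 01JO] -/
theorem Over.comp_left_eq_of_pullback_map_eq_of_lift {S S' : Scheme.{u}} (ι : S' ⟶ S)
    {X Y : Over S} (f g : X ⟶ Y) (h : (Over.pullback ι).map f = (Over.pullback ι).map g)
    (j : S' ⟶ X.left) (hj : j ≫ X.hom = ι) : j ≫ f.left = j ≫ g.left := by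
  have h' := congrArg (fun m => pullback.lift j (𝟙 S') (by rw [hj, Category.id_comp]) ≫ m)
    (Over.pullback_fst_comp_left_eq_of_pullback_map_eq ι f g h)
  simpa only [← Category.assoc, pullback.lift_fst] using h'

/-- If two sections `f, g : 𝟙_ (Over S) → Y` of `Y → S` have the same base change along `ι : S' → S` —
`(Over.pullback ι).map f = (Over.pullback ι).map g`, i.e. the induced sections of `Y ×_S S' → S'`
coincide — then `ι ≫ f = ι ≫ g` on underlying schemes. [cite: StacksProject, Tag 01JO] -/
theorem Over.comp_left_eq_of_pullback_map_eq {S S' : Scheme.{u}} (ι : S' ⟶ S) {Y : Over S}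
    (f g : 𝟙_ (Over S) ⟶ Y) (h : (Over.pullback ι).map f = (Over.pullback ι).map g) :
    ι ≫ f.left = ι ≫ g.left :=
  Over.comp_left_eq_of_pullback_map_eq_of_lift ι f g h ι (Category.comp_id ι)

/-- **Sections of a separated scheme over a Dedekind base with equal reductions at infinitely many
primes are equal** (base-change form).  Let `R` be a Dedekind domain, `𝒜 → Spec R` separated and
`s₁, s₂ : 𝟙_ → 𝒜` two sections.  If for an infinite set `T` of primes `𝔭` the base changes of `s₁` and
`s₂` along `Spec (R ⧸ 𝔭) → Spec R` coincide (equal reductions `s_i mod 𝔭` as sections of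
`𝒜 ⊗_R R/𝔭`), then `s₁ = s₂`. [cite: Hartshorne1977, II Ex. 4.2] -/
theorem Over.tensorUnit_hom_ext_of_infinite_pullback {R : Type u} [CommRing R] [IsDedekindDomain R]
    {𝒜 : Over (Spec (CommRingCat.of R))} [IsSeparated 𝒜.hom]
    (s₁ s₂ : 𝟙_ (Over (Spec (CommRingCat.of R))) ⟶ 𝒜) (T : Set (Ideal R)) (hT : T.Infinite)
    (hprime : ∀ 𝔭 ∈ T, 𝔭.IsPrime)
    (H : ∀ (𝔭 : Ideal R) (h𝔭 : 𝔭 ∈ T),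
      (Over.pullback (Spec.map (CommRingCat.ofHom (Ideal.Quotient.mk 𝔭)))).map s₁ =
        (Over.pullback (Spec.map (CommRingCat.ofHom (Ideal.Quotient.mk 𝔭)))).map s₂) :
    s₁ = s₂ :=
  Over.tensorUnit_hom_ext_of_infinite_quotient s₁ s₂ T hT hprime fun 𝔭 h𝔭 =>
    Over.comp_left_eq_of_pullback_map_eq _ s₁ s₂ (H 𝔭 h𝔭)

/-! ### The form consumed by the specialisation argument: all maximal ideals, infinitely many of them -/

/-- **Sections with equal reductions at every closed point.**  Let `R` be a Dedekind domain with
infinitely many maximal ideals (e.g. a ring of `S`-integers of a global field, or the coordinate ring of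
an affine curve over a field), `𝒜 → Spec R` separated, and `s₁, s₂ : 𝟙_ → 𝒜` sections whose
restrictions to `Spec (R ⧸ 𝔪)` agree for EVERY maximal ideal `𝔪`.  Then `s₁ = s₂`. [cite: Hartshorne1977, II Ex. 4.2] -/
theorem Over.tensorUnit_hom_ext_of_forall_maximal_quotient {R : Type u} [CommRing R]
    [IsDedekindDomain R] (hR : {𝔪 : Ideal R | 𝔪.IsMaximal}.Infinite)
    {𝒜 : Over (Spec (CommRingCat.of R))} [IsSeparated 𝒜.hom]
    (s₁ s₂ : 𝟙_ (Over (Spec (CommRingCat.of R))) ⟶ 𝒜)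
    (H : ∀ (𝔪 : Ideal R), 𝔪.IsMaximal →
      Spec.map (CommRingCat.ofHom (Ideal.Quotient.mk 𝔪)) ≫ s₁.left =
        Spec.map (CommRingCat.ofHom (Ideal.Quotient.mk 𝔪)) ≫ s₂.left) :
    s₁ = s₂ :=
  Over.tensorUnit_hom_ext_of_infinite_quotient s₁ s₂ {𝔪 : Ideal R | 𝔪.IsMaximal} hR
    (fun _ h𝔪 => Ideal.IsMaximal.isPrime h𝔪) fun 𝔪 h𝔪 => H 𝔪 h𝔪

/-- **Sections with equal reductions at every closed point** (base-change form).  Let `R` be a Dedekind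
domain with infinitely many maximal ideals, `𝒜 → Spec R` separated, and `s₁, s₂ : 𝟙_ → 𝒜` sections
whose base changes to `𝒜 ⊗_R R/𝔪` agree for EVERY maximal ideal `𝔪`.  Then `s₁ = s₂`. [cite: Hartshorne1977, II Ex. 4.2] -/
theorem Over.tensorUnit_hom_ext_of_forall_maximal_pullback {R : Type u} [CommRing R]
    [IsDedekindDomain R] (hR : {𝔪 : Ideal R | 𝔪.IsMaximal}.Infinite)
    {𝒜 : Over (Spec (CommRingCat.of R))} [IsSeparated 𝒜.hom]
    (s₁ s₂ : 𝟙_ (Over (Spec (CommRingCat.of R))) ⟶ 𝒜)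
    (H : ∀ (𝔪 : Ideal R), 𝔪.IsMaximal →
      (Over.pullback (Spec.map (CommRingCat.ofHom (Ideal.Quotient.mk 𝔪)))).map s₁ =
        (Over.pullback (Spec.map (CommRingCat.ofHom (Ideal.Quotient.mk 𝔪)))).map s₂) :
    s₁ = s₂ :=
  Over.tensorUnit_hom_ext_of_infinite_pullback s₁ s₂ {𝔪 : Ideal R | 𝔪.IsMaximal} hR
    (fun _ h𝔪 => Ideal.IsMaximal.isPrime h𝔪) fun 𝔪 h𝔪 => H 𝔪 h𝔪

end Literature.AlgebraicGeometry.Morphisms
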